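/-
Copyright (c) 2026 the pub-hodgecm-mathlib formalisation cell (harness21).  Prover seat hodgecm-mathlib-K2E2-p12 (g7): Track B «K2-LIT», ENGINE E1,
h413 = stmt-HodgeConjecture-24833; line `K2_E1_TraceFormulaBeta`, 5Res campaign, amendment #3 G8 (`hsymm_τ`), road (R) «ADJOINT + GALOIS REALITY» file (R3) (K2E1-plan (g7)
(285) GO): GALOIS REALITY of Hecke symbols — `c_G` preserves the Haar measure of `G(𝔸_F)`, `ψ ↦ conj ∘ ψ ∘ c_G` preserves the `χ`-sections of a SELF-DUAL UNITARY `χ` (and the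
level space `V(χ, K′, ω)` at a `c_G`-stable `K′`), and the symbol of `h^θ = conj ∘ h ∘ c_G` on `conj ∘ ψ₀ ∘ c_G` is `z ↦ conj s(conj z)`.
-/
import Summits.HodgeConjecture.HodgeConjecture.Theorems.K2E1ChiSectionGaloisTwistU2        -- ★ K2E1-p13 p860352: `apply_galTwist_borel_mul`, `apply_units_map_conjAdele_of_selfDual`; brings ★ p860213 `K2E1QuasiSplitGaloisTwistU2` (`galTwist_galTwist`, `borelHeight_galTwist`, `flatSectionU_galTwist_apply`)
import Summits.HodgeConjecture.HodgeConjecture.Theorems.K2E1ChiSectionSpaceU2Defs          -- ★ `chiSectionSpace χ K′ ω`, `mem_chiSectionSpace_iff`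
import Summits.HodgeConjecture.HodgeConjecture.Theorems.K2E1AntiAutHaarPreservingU           -- ★ K2E2-p12 (g6) p860556: `map_eq_self_of_involutive` (an involutive continuous automorphism preserves every Haar measure)
import Literature.NumberTheory.EllipticCurves.Gamma1NewformFunctionalEquationProofs           -- ★ `conj_ofReal_cpow`
import HarnessLib

/-!
# K2·E1 — `K2E1ChiSymbolGaloisRealityU2` (road (R), file (R3)): GALOIS REALITY OF HECKE SYMBOLS — `(c_G)_* ν_G = ν_G`; `conj ∘ ψ ∘ c_G` IS A `χ`-SECTION FOR SELF-DUAL UNITARY `χ`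
# (and lies in `V(χ, K′, ω)` at a `c_G`-stable level); THE SYMBOL OF `h^θ = conj ∘ h ∘ c_G` ON `conj ∘ ψ₀ ∘ c_G` IS `z ↦ conj s(conj z)`

Track B ∕ K2-LIT, crux h413 = `stmt-HodgeConjecture-24833`, route of record `HCCMUnconditional`; cell `hodgecm-mathlib`, squad K2, ENGINE E1 (5Res campaign, amendment #3 «general (U,τ)
ladder», rung G8: the letter `hsymm_τ`; dealer K2E1-plan (g7) ruling (285): road (R) GO).  THEOREMS ONLY (no `def`, no `instance`, no notation, no named-fact hypothesis, no `sorry`; default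
heartbeats); lane `--supports stmt-HodgeConjecture-24833 --as helper` (count-neutral).  CLOSES NO SOCKET.  Rank-generic `(F, E, c, N)` with `c² = 1`; the Galois twist is the
hypothesis-first binder `cG` with ★ (hcG) `adelicVal (cG g) = GL.map (c ⊗ 1) (adelicVal g)` of ★ `K2E1QuasiSplitGaloisTwistU2` (inhabited by ★ `exists_galTwist`).

THE MATHEMATICS ([MoeglinWaldspurger1995, I.1.4, II.1.5–II.1.7]; [GelbartRogawski1991, §3.1]; [DeitmarEchterhoff2014, Thm. 1.3.4]).  `G = U(J_N)` is defined over `F`, so `c ∈ Gal(E∕F)` acts on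
`G(𝔸_F)` by the continuous involutive automorphism `c_G` (entrywise `c ⊗ 1`).  (i) `c_G` is a homeomorphic group automorphism of order two, hence PRESERVES EVERY HAAR MEASURE of `G(𝔸_F)`
(★ `map_eq_self_of_involutive`: the Haar scalar factor `a` of `(c_G)_* ν_G` has `a² = 1`): `∫ F(c_G y) dν_G = ∫ F dν_G` (§1).  (ii) For a SELF-DUAL (`χʷ = χ`) UNITARY `χ`, `χ((c⊗1)a) = conj χ(a)`
(★ (S3)), so for a `χ`-section `ψ` (`ψ(b g) = χ(b₀₀)ψ(g)`) the function `ψ^θ := conj ∘ ψ ∘ c_G` is again a `χ`-section (★ (S2)); at a level `K′` with `c_G(K′) ⊆ K′` and `conj ω(c_G k) = ω(k)`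
(unitary `K_∞`-characters ✓; `c`-stable finite level ✓) `ψ ∈ V(χ, K′, ω) ⇒ ψ^θ ∈ V(χ, K′, ω)`; and `f_z^{ψ^θ}(x) = conj f_{z̄}^{ψ}(c_G x)` (`H ∘ c_G = H` ★, real positive base) (§2).
(iii) THE REALITY TRANSPORT (§3): if `∫ h(y) f_z^{ψ₀}(x y) dν_G = s(z) f_z^{ψ₀}(x)` for all `z, x`, then for `h^θ := conj ∘ h ∘ c_G`,
`∫ h^θ(y) f_z^{ψ₀^θ}(x y) dν_G = conj ∫ h(c_G y) f_{z̄}^{ψ₀}(c_G x · c_G y) dν_G = conj ∫ h(y′) f_{z̄}^{ψ₀}(c_G x · y′) dν_G = conj(s(z̄))·conj f_{z̄}^{ψ₀}(c_G x) = conj(s(z̄))·f_z^{ψ₀^θ}(x)` — the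
symbol of `h^θ` on `ψ₀^θ` is **`z ↦ conj s(conj z)`**.  With the adjoint identity ★ (R2) `s_h(z) = conj s_{h†}(1 − z̄)` and the transpose condition `(h†)^θ = h` this closes `hsymm_τ`:
`s(1 − z) = s(z)` (file (R4)).
* §1 `exists_continuousMulEquiv_galTwist` (`c_G` as `G ≃ₜ* G`), **`integral_comp_galTwist`** (`∫ F(c_G y) dν_G = ∫ F dν_G`, every `F`, every Haar `ν_G`).
* §2 **`isChiSection_conj_comp_galTwist`**, **`conj_comp_galTwist_mem_chiSectionSpace`** (letters `hK`, `hω`), `flatSectionU_conj_comp_galTwist`.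
* §3 HEAD **`symbol_conj_comp_galTwist`** (`∀ z x, ∫ conj(h(c_G y))·f_z^{ψ₀^θ}(x y) dν_G = conj(s(conj z))·f_z^{ψ₀^θ}(x)`).
HONEST LABEL: HC_CM is proved only modulo the 7 printed citations (2 remaining named inputs: hLiu418 = `stmt-HodgeConjecture-24832`, h413 = `stmt-HodgeConjecture-24833`) until rung 0
closes; this file asserts no named fact and closes no socket; count-neutral; letters: (hcG), `c² = 1`, self-duality∕unitarity of `χ`, `hK`∕`hω` for the level clause.

## References
* [MoeglinWaldspurger1995] C. Mœglin, J.-L. Waldspurger, *Spectral decomposition and Eisenstein series* (1995), I.1.4, II.1.5–II.1.7.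
* [GelbartRogawski1991] S. Gelbart, J. Rogawski, *L-functions and Fourier–Jacobi coefficients for the unitary group U(3)*, Invent. Math. 105 (1991), §3.1.
* [DeitmarEchterhoff2014] A. Deitmar, S. Echterhoff, *Principles of Harmonic Analysis*, 2nd ed. (2014), Thm. 1.3.4.
-/

set_option autoImplicit false
set_option linter.dupNamespace false -- the mandated namespace repeats `HodgeConjecture.HodgeConjecture`

noncomputable section

open MeasureTheory MeasureTheory.Measure Set Filter Topology Function NumberField IsDedekindDomain
open scoped NNReal ENNReal ComplexConjugate MatrixGroups
open Literature.NumberTheory Literature.NumberTheory.Automorphic Literature.NumberTheory.Automorphic.UnitaryGroup AdelicGroupData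
open Literature.NumberTheory.GaloisRepresentations (HeckeCharacter)
open Summit.HodgeConjecture.HodgeConjecture.Cruxes.H413.K2E1BorelEisensteinU
open Summit.HodgeConjecture.HodgeConjecture.Cruxes.H413.K2E1CharacterEisensteinU2Defs
open Summit.HodgeConjecture.HodgeConjecture.Cruxes.H413.K2E1ChiSectionSpaceU2Defs
open Summit.HodgeConjecture.HodgeConjecture.Cruxes.H413.K2E1QuasiSplitGaloisTwistU2 (galTwist_galTwist borelHeight_galTwist flatSectionU_galTwist_apply galTwist_mem_borelAdelic_iff)
open Summit.HodgeConjecture.HodgeConjecture.Cruxes.H413.K2E1ChiSectionGaloisTwistU2 (apply_galTwist_borel_mul apply_units_map_conjAdele_of_selfDual)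

namespace Summit.HodgeConjecture.HodgeConjecture.Cruxes.H413.K2E1ChiSymbolGaloisRealityU2

variable {F E : Type} [Field F] [NumberField F] [Field E] [NumberField E] [Algebra F E] {c : E ≃ₐ[F] E} {N : ℕ}

/-! ## §1 `c_G` is a continuous involutive automorphism, hence Haar-measure preserving -/

/-- **`c_G` AS A HOMEOMORPHIC GROUP AUTOMORPHISM `G ≃ₜ* G`** (`c² = 1`): continuous because `adelicVal ∘ c_G = GL.map (c ⊗ 1) ∘ adelicVal` with `c ⊗ 1` continuous (★ `continuous_conjAdele`) and the
topology of `G(𝔸_F)` induced from `GL_N(𝔸_E)`; its own inverse (★ `galTwist_galTwist`). [cite: MoeglinWaldspurger1995, I.1.4] -/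
theorem exists_continuousMulEquiv_galTwist (hc : c * c = 1) {cG : (quasiSplit F E c N).Adelic →* (quasiSplit F E c N).Adelic}
    (hcG : ∀ g, adelicVal F E c N _ (cG g) = Matrix.GeneralLinearGroup.map (conjAdele F E c) (adelicVal F E c N _ g)) :
    ∃ θ : (quasiSplit F E c N).Adelic ≃ₜ* (quasiSplit F E c N).Adelic, ∀ g, θ g = cG g := by
  have hcont : Continuous cG := by
    show Continuous (fun g : ↥(adelic F E c N ((StdForm.antidiagonal N).over E)) => cG g)
    refine continuous_induced_rng.2 ?_
    show Continuous fun g : ↥(adelic F E c N ((StdForm.antidiagonal N).over E)) => adelicVal F E c N _ (cG g)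
    simp_rw [hcG]
    exact (Continuous.units_map _ (continuous_id.matrix_map (continuous_conjAdele F E c))).comp continuous_subtype_val
  refine ⟨{ toFun := cG, invFun := cG, left_inv := fun g => galTwist_galTwist hc hcG g, right_inv := fun g => galTwist_galTwist hc hcG g,
            map_mul' := fun x y => map_mul cG x y, continuous_toFun := hcont, continuous_invFun := hcont }, fun g => rfl⟩

section Haar

variable [MeasurableSpace (quasiSplit F E c N).Adelic] [BorelSpace (quasiSplit F E c N).Adelic]

/-- **`(c_G)_* ν_G = ν_G`: `∫ F(c_G y) dν_G = ∫ F dν_G` FOR EVERY HAAR MEASURE `ν_G` OF `G(𝔸_F)` AND EVERY `F`** — `c_G` is a continuous involutive automorphism (§1), ★ `map_eq_self_of_involutive`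
(Haar scalar factor `a² = 1`), and the change of variables along the measurable equivalence. [cite: DeitmarEchterhoff2014, Thm. 1.3.4] [cite: MoeglinWaldspurger1995, I.1.4] -/
theorem integral_comp_galTwist (hc : c * c = 1) {cG : (quasiSplit F E c N).Adelic →* (quasiSplit F E c N).Adelic}
    (hcG : ∀ g, adelicVal F E c N _ (cG g) = Matrix.GeneralLinearGroup.map (conjAdele F E c) (adelicVal F E c N _ g))
    (νG : Measure (quasiSplit F E c N).Adelic) [νG.IsHaarMeasure] (Φ : (quasiSplit F E c N).Adelic → ℂ) :
    ∫ y, Φ (cG y) ∂νG = ∫ y, Φ y ∂νG := by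
  haveI := t2Space_adeleRing_of_numberField E
  haveI := locallyCompactSpace_adeleRing' E
  haveI := secondCountableTopology_adeleRing E
  haveI : SecondCountableTopology (quasiSplit F E c N).Adelic := inferInstanceAs (SecondCountableTopology (adelic F E c N ((StdForm.antidiagonal N).over E)))
  haveI : LocallyCompactSpace (quasiSplit F E c N).Adelic := inferInstanceAs (LocallyCompactSpace (adelic F E c N ((StdForm.antidiagonal N).over E)))
  obtain ⟨θ, hθ⟩ := exists_continuousMulEquiv_galTwist hc hcG
  have hmap : Measure.map θ νG = νG :=
    K2E1AntiAutHaarPreservingU.map_eq_self_of_involutive νG θ fun x => by rw [hθ, hθ]; exact galTwist_galTwist hc hcG x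
  have hmp : MeasurePreserving θ νG νG := ⟨θ.continuous.measurable, hmap⟩
  have h1 : ∫ y, Φ (θ y) ∂νG = ∫ y, Φ y ∂νG :=
    hmp.integral_comp (θ : (quasiSplit F E c N).Adelic ≃ₜ (quasiSplit F E c N).Adelic).measurableEmbedding Φ
  rw [← h1]
  exact integral_congr_ae (Eventually.of_forall fun y => by simp only [hθ])

end Haar

/-! ## §2 `conj ∘ ψ ∘ c_G` is a `χ`-section for self-dual unitary `χ`; the level clause; the flat sections -/

/-- **`ψ^θ := conj ∘ ψ ∘ c_G` IS A `χ`-SECTION** for a SELF-DUAL UNITARY `χ` and a `χ`-section `ψ`: `ψ^θ(b g) = conj(χ((c⊗1)b₀₀)·ψ(c_G g)) = conj(conj χ(b₀₀))·ψ^θ(g) = χ(b₀₀)·ψ^θ(g)`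
(★ (S2) `apply_galTwist_borel_mul`, ★ (S3) `apply_units_map_conjAdele_of_selfDual`). [cite: MoeglinWaldspurger1995, II.1.7] [cite: GelbartRogawski1991, §3.1] -/
theorem isChiSection_conj_comp_galTwist [NeZero N] (hc : c * c = 1) {cG : (quasiSplit F E c N).Adelic →* (quasiSplit F E c N).Adelic}
    (hcG : ∀ g, adelicVal F E c N _ (cG g) = Matrix.GeneralLinearGroup.map (conjAdele F E c) (adelicVal F E c N _ g))
    {χ : HeckeCharacter E} (hsd : reflectChar c χ = χ) (hχ : χ.IsUnitary) {ψ : (quasiSplit F E c N).Adelic → ℂ} (hψ : IsChiSection χ ψ) :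
    IsChiSection χ (fun g => conj (ψ (cG g))) := fun b hb g => by
  show conj (ψ (cG (b * g))) = ((χ (firstEntryUnit hb) : ℂˣ) : ℂ) * conj (ψ (cG g))
  rw [apply_galTwist_borel_mul hc hcG hψ hb g, map_mul, apply_units_map_conjAdele_of_selfDual hsd hχ, Complex.conj_conj]

/-- **THE LEVEL CLAUSE: `ψ ∈ V(χ, K′, ω) ⇒ conj ∘ ψ ∘ c_G ∈ V(χ, K′, ω)`** at a `c_G`-STABLE level — letters `hK : c_G(K′) ⊆ K′` and `hω : conj ω(c_G k) = ω(k)` (every unitary `K_∞`-character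
composed with a `c`-stable finite level). [cite: MoeglinWaldspurger1995, I.2.17, II.1.7] -/
theorem conj_comp_galTwist_mem_chiSectionSpace [NeZero N] (hc : c * c = 1) {cG : (quasiSplit F E c N).Adelic →* (quasiSplit F E c N).Adelic}
    (hcG : ∀ g, adelicVal F E c N _ (cG g) = Matrix.GeneralLinearGroup.map (conjAdele F E c) (adelicVal F E c N _ g))
    {χ : HeckeCharacter E} (hsd : reflectChar c χ = χ) (hχ : χ.IsUnitary) {K' : Subgroup (quasiSplit F E c N).Adelic} {ω : ↥K' → ℂ}
    (hK : ∀ k : ↥K', cG (k : (quasiSplit F E c N).Adelic) ∈ K') (hω : ∀ k : ↥K', conj (ω ⟨cG (k : (quasiSplit F E c N).Adelic), hK k⟩) = ω k)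
    {ψ : (quasiSplit F E c N).Adelic → ℂ} (hψ : ψ ∈ chiSectionSpace χ K' ω) :
    (fun g => conj (ψ (cG g))) ∈ chiSectionSpace χ K' ω := by
  refine (mem_chiSectionSpace_iff _).2 ⟨isChiSection_conj_comp_galTwist hc hcG hsd hχ (isChiSection_of_mem hψ), fun g k => ?_⟩
  show conj (ψ (cG (g * (k : (quasiSplit F E c N).Adelic)))) = ω k * conj (ψ (cG g))
  rw [map_mul, show cG (k : (quasiSplit F E c N).Adelic) = ((⟨cG (k : (quasiSplit F E c N).Adelic), hK k⟩ : ↥K') : (quasiSplit F E c N).Adelic) from rfl,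
    apply_mul_of_mem hψ, map_mul, hω k]

/-- **`f_z^{ψ^θ}(x) = conj f_{z̄}^{ψ}(c_G x)`** (`ψ^θ = conj ∘ ψ ∘ c_G`): `H(c_G x) = H(x)` (★ `borelHeight_galTwist`) and `conj(H^{z̄}) = H^{z}` for the positive real base `H`. [cite: MoeglinWaldspurger1995, II.1.5] -/
theorem flatSectionU_conj_comp_galTwist [NeZero N] {cG : (quasiSplit F E c N).Adelic →* (quasiSplit F E c N).Adelic}
    (hcG : ∀ g, adelicVal F E c N _ (cG g) = Matrix.GeneralLinearGroup.map (conjAdele F E c) (adelicVal F E c N _ g))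
    (ψ : (quasiSplit F E c N).Adelic → ℂ) (z : ℂ) (x : (quasiSplit F E c N).Adelic) :
    flatSectionU (fun g => conj (ψ (cG g))) z x = conj (flatSectionU ψ (conj z) (cG x)) := by
  rw [flatSectionU_apply, flatSectionU_galTwist_apply hcG ψ (conj z) x, map_mul,
    Literature.NumberTheory.EllipticCurves.ModularForms.conj_ofReal_cpow (NNReal.coe_nonneg _), Complex.conj_conj]

/-! ## §3 HEAD: the symbol of `h^θ = conj ∘ h ∘ c_G` on `ψ₀^θ` is `z ↦ conj s(conj z)` -/

section Symbol

variable [NeZero N] [MeasurableSpace (quasiSplit F E c N).Adelic] [BorelSpace (quasiSplit F E c N).Adelic]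

/-- **GALOIS REALITY OF HECKE SYMBOLS.**  `c² = 1`, (hcG); `ν_G` a Haar measure of `G(𝔸_F)`; `ψ₀ : G → ℂ` and `h : G → ℂ` with the symbol law `∫ h(y) f_z^{ψ₀}(x y) dν_G = s(z) f_z^{ψ₀}(x)` for all
`z, x`.  THEN for `h^θ := conj ∘ h ∘ c_G` and `ψ₀^θ := conj ∘ ψ₀ ∘ c_G`: **`∀ z x, ∫ conj(h(c_G y))·f_z^{ψ₀^θ}(x y) dν_G = conj(s(conj z))·f_z^{ψ₀^θ}(x)`** — the integrand is
`conj(h(c_G y)·f_{z̄}^{ψ₀}(c_G x·c_G y))` (§2), the integral is `conj ∫ h(c_G y) f_{z̄}^{ψ₀}(c_G x·c_G y) = conj ∫ h(y′) f_{z̄}^{ψ₀}(c_G x·y′)` (§1, `(c_G)_*ν_G = ν_G`) `= conj(s(z̄) f_{z̄}^{ψ₀}(c_G x))`.  No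
hypothesis on `χ`: reality is a property of the triple `(h, ψ₀, s)`; §2 says when `ψ₀^θ` is again a section of the same space. [cite: MoeglinWaldspurger1995, II.1.6–II.1.7] [cite: GelbartRogawski1991, §3.1] -/
theorem symbol_conj_comp_galTwist (hc : c * c = 1) {cG : (quasiSplit F E c N).Adelic →* (quasiSplit F E c N).Adelic}
    (hcG : ∀ g, adelicVal F E c N _ (cG g) = Matrix.GeneralLinearGroup.map (conjAdele F E c) (adelicVal F E c N _ g))
    (νG : Measure (quasiSplit F E c N).Adelic) [νG.IsHaarMeasure]
    {ψ₀ h : (quasiSplit F E c N).Adelic → ℂ} {s : ℂ → ℂ}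
    (hR : ∀ (z : ℂ) (x : (quasiSplit F E c N).Adelic), ∫ y, h y * flatSectionU ψ₀ z (x * y) ∂νG = s z * flatSectionU ψ₀ z x)
    (z : ℂ) (x : (quasiSplit F E c N).Adelic) :
    ∫ y, conj (h (cG y)) * flatSectionU (fun g => conj (ψ₀ (cG g))) z (x * y) ∂νG = conj (s (conj z)) * flatSectionU (fun g => conj (ψ₀ (cG g))) z x := by
  have e1 : ∀ y, conj (h (cG y)) * flatSectionU (fun g => conj (ψ₀ (cG g))) z (x * y) = conj (h (cG y) * flatSectionU ψ₀ (conj z) (cG x * cG y)) := fun y => by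
    rw [flatSectionU_conj_comp_galTwist hcG ψ₀ z (x * y), map_mul cG x y, map_mul]
  simp_rw [e1]
  rw [integral_conj, integral_comp_galTwist hc hcG νG (fun y => h y * flatSectionU ψ₀ (conj z) (cG x * y)), hR (conj z) (cG x), map_mul,
    flatSectionU_conj_comp_galTwist hcG ψ₀ z x]

end Symbol

end Summit.HodgeConjecture.HodgeConjecture.Cruxes.H413.K2E1ChiSymbolGaloisRealityU2

end
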